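import Mathlib
import HarnessLib
import HarnessLib.Audit
import Summits.ValiantsHypothesis.Statement
import Literature.Computability.AlgebraicComplexity.CosetComplexity
import Literature.Computability.AlgebraicComplexity.PermanentIrreducible
import Literature.Computability.AlgebraicComplexity.ValiantConjectureProofs
import Summits.ValiantsHypothesis.ValiantsHypothesis.Theorems.HubHub
import HarnessLib.Audit.Status.Attr

/-!
Route: ForgivenCollisions

DORMANT since 2026-08-23T20:01:48Z (reconciler: no traction for 6.2 d (last activity item-evidence-added at 2026-08-17T14:28:53Z); parked, not closed — `ledger route dormant route-ValiantsHypothesis-ForgivenCollisions --off` to reactiva) — unstaffed, not closed; items shared with open routes are served there. `ledger route dormant <id> --off` reactivates.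

# Route ForgivenCollisions — forgive the collisions — per_n is a product of linear forms modulo the
rook relations; buying back r collisions costs syndrome memory n^Θ(r)

It suffices to show X = UNIFORM COLLISION LAW (card forgiven-collisions-design-law, spine and only
card; typed item `UniformLaw`): for
every c there are r and n₀ such that for all n ≥ n₀ EVERY polynomial P ∈ ℂ[x_ij] congruent to per_n
modulo the collision ideal J_r(n)
needs more than n^c + c gates, i.e. κ_r(n) := cosetComplexity (J_r n) per_n (tree
`CosetComplexity.lean`) is not p-bounded uniformly in r.
Here J_r(n) is the monomial ideal spanned by the monomials having a row or a column of degree ≥ 3,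
or at least r rows-or-columns of degree
≥ 2 ("r double occupancies"); J_1 ⊇ J_2 ⊇ ⋯, and P ≡ per_n mod J_r says exactly: coefficient 1 on
permutation monomials, 0 on every
monomial with 1 … r−1 doubly occupied lines and no triple, anything on heavier collisions (support
CoeffAgreement). Since per_n lies in its
own coset, κ_1(n) ≤ κ_2(n) ≤ ⋯ ≤ L(per_n), so X is stronger than per ∉ VP_ℂ and the assembly is one
line through the hub. The graded form
(crux GradedLaw: κ_r(n) ≥ n^(γ·r) at every fixed rung) is the card's thesis; two of its
restricted-model versions are theorems on paper
at open (supports OrderedLaw, DepthThreeRung), filed for provers.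
Lean: `∀ c : ℕ, ∃ r n₀ : ℕ, ∀ n : ℕ, n₀ ≤ n → n ^ c + c <
Literature.Computability.AlgebraicComplexity.cosetComplexity (Ideal.span ((fun d : Fin n × Fin n →₀
ℕ => MvPolynomial.monomial d (1 : ℂ)) '' {d | ((∃ i : Fin n, 3 ≤
Literature.Computability.AlgebraicComplexity.rowCount d i) ∨ (∃ j : Fin n, 3 ≤
Literature.Computability.AlgebraicComplexity.colCount d j) ∨ r ≤ (Finset.univ.filter fun i : Fin n
=> 2 ≤ Literature.Computability.AlgebraicComplexity.rowCount d i).card + (Finset.univ.filter fun j :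
Fin n => 2 ≤ Literature.Computability.AlgebraicComplexity.colCount d j).card)}))
(Literature.Computability.AlgebraicComplexity.perPoly (Fin n) ℂ)`

## Assembly
Pure logic over PROVED tree facts (sorry-free in Sketch.lean; it is the deciding theorem `closes` of
glue.lean, which takes all fourteen
items as hypotheses and uses only UniformLaw): if per were a VP family over ℂ, IsPComputable gives c
with L(per_n) ≤ n^c + c for all n;
UniformLaw at this c gives r, n₀ with n₀^c + c < κ_r(n₀) ≤ L(per_(n₀))
(cosetComplexity_le_complexity: per lies in its own coset) —
contradiction; so ¬ IsVPFamily (perPoly (Fin n) ℂ), and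
Summit.ValiantsHypothesis.Hub.valiantsHypothesis_of_not_isVPFamily_per with
mem_VP_ofFintype_iff_holds and perFamily_mem_VNP_holds ℂ gives VP_ℂ ≠ VNP_ℂ. GradedLaw → UniformLaw
is the support GradedToUniform; the
other items are the rungs (FirstRung, MonotoneLaw: conjectural; MonotoneEndpoint, OrderedLaw,
DepthThreeRung: theorems on paper) and the buy-back side
(Syndrome*, Counter*, PurePowerAnchor, CoeffAgreement).

Rationale: WHY THIS LINE. FORGIVE THE COLLISIONS, THEN BUY THEM BACK. Modulo J_1 the permanent is free: per_n ≡
Π_i(Σ_j x_ij) ≡ (Σ_ij x_ij)^n/n! (supports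
SyndromeRepresentative at r = 1 and PurePowerAnchor; κ_1(n) ≤ n² − 1), so all of the permanent's
hardness is collision bookkeeping, and the
rungs price it: the planner's check of the card found that its signed orthogonal-array Glynn
representative modulo J_r is, for a LINEAR array
Z = C^⊥, the 0/1 polynomial Σ_{j : c(j)+𝟙 ∈ C} x_j (E_{z∈C^⊥} z^v = [v ∈ C]) — equivalently a
SYNDROME dynamic programme over an abelian
group G with a B_(r−1)-separated labelling g : [n] → G (Bose–Chowla / Reed–Solomon–BCH,
doi:10.1007/BF02566968, doi:10.1016/0196-6774(86)90019-2;
Pratt2019 Thm 53 is the same device with G = ℤ_2^n killing ALL squares, KoutisWilliams2009),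
monotone, of size ≤ 2^r·(n+1)^(r+1)
(SyndromeUpperBound; mod-n counter at r = 2, CounterRepresentative). So κ_r is a MEMORY ladder
interpolating between the product of row
sums (r = 1, no state) and the column-subset DP / Ryser (r ~ n, 2^n states): rung r = remembering a
(2r−2)-wise independent syndrome,
(n+1)^(r−1) states; cancellation only buys the FFT factor (κ_r ≤ O(r·n^r·log n)). This corrects the
card (its monotone crux K3(b) is
false and is not filed; its first rung moves from r = 2 to r = 3) and sharpens it: the immunity
lemma (a coefficient minor indexed by
rook-legal monomials never meets J_r and is an identity on a Johnson ANTICODE) proves the law with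
the TIGHT exponent r−1 in row-ordered
models (OrderedLaw, Nisan1991Noncommutative made garbage-immune; anticode = diametric Erdős–Ko–Rado
family) and within a factor 2 in the
exponent for homogeneous ΣΠΣ (DepthThreeRung, NisanWigderson1996 partials). Imported areas: coding
theory (syndromes, B_h sets, dual codes
= orthogonal arrays, Delsarte1973), apolarity / partial derivatives, and the coset-complexity frame
of proof complexity (GrochowPitassi2018 §6,
AndrewsForbes2022 §1.3). What no prior route does: HartogsRankTwo forgives RANK (the nonlinear
determinantal ideal I_3, engine division
elimination); SummationBits / RyserTripartition / RigidityForcesSymmetry bet on the r ~ n endpoint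
(Ryser optimality, 2^((1−ε)n)); here
every FIXED rung is a fixed-polynomial statement n^Θ(r) about an explicit monomial coset of per_n,
with the general-circuit content
isolated in GradedLaw / FirstRung and a cancellation-free version in MonotoneLaw; the negatives
index (Elusive Sidon curve, Grenet
uniqueness) is disjoint from the line.

RANKED CRUXES. #0 UniformLaw (target) — UNIFORM COLLISION LAW: for every c there are r, n₀ with
κ_r(n) = min{L(P) : P ≡ per_n mod J_r(n)} > n^c + c for all n ≥ n₀ (card Assembly-sketch X). (why it
might fail: Strictly stronger than per ∉ VP: it already fails if the single coset per_n + J_∞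
(garbage = some line of degree ≥ 3) has n^O(1)-size members infinitely often, which VH does not
forbid (recovering per_n from such a member costs 3^(2n) interpolation points).) [Valiant1979,
Burgisser2000, GrochowPitassi2018, AndrewsForbes2022, Glynn2010]
#2 GradedLaw (crux) — GRADED COLLISION LAW (card THESIS; the engine): there is γ > 0 such that for
every r ≥ 1 and all large n, κ_r(n) ≥ n^(γ·r) — at no fixed rung can general circuits beat syndrome
memory (n+1)^(r−1) by more than a polynomial in the exponent (γ ≤ 1 is forced by SyndromeUpperBound
+ FFT, κ_r ≤ O(r·n^r·log n)). Implies UniformLaw (support GradedToUniform). [difficulty: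
open-problem] (why it might fail: From r > 2/γ on it asserts super-linear (in N = n²) lower bounds
for constant-individual-degree cosets; no technique beyond Baur–Strassen Ω(N log d) exists and that
needs individual degree d; a representative sharing state across rows AND columns at cost n^o(r)
refutes it.) [BaurStrassen1983, ChatterjeeKumarSheVolk2022, Nisan1991Noncommutative, Pratt2019,
doi:10.1016/0196-6774(86)90019-2, GrochowPitassi2018]
#3 FirstRung (crux) — FIRST RUNG WITH ROOM: there is δ > 0 with κ_3(n) ≥ n^(2+δ) for all large n —
buying back the SECOND collision costs a polynomial factor over the input size n² (κ_1 ≤ n² − 1; κ_2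
≤ O(n²·log n) by the mod-n counter + FFT, so r = 2 has only a log of room and is deliberately not
filed; κ_3 ≤ O(n³·log n) by the Sidon syndrome (j, j²) mod p, conjecturally tight). [difficulty:
open-problem] (why it might fail: κ_3 ≤ L(per_n), so this is a super-linear circuit lower bound for
the permanent itself, unknown for every constant-individual-degree polynomial (CKSV 2022 §1: only
Baur–Strassen/Kalorkoti-type bounds exist); an O(n²·polylog) non-ordered representative mod J_3
beating Sidon memory n²/2 kills it.) [BaurStrassen1983, Kalorkoti1985, ChatterjeeKumarSheVolk2022,
Strassen1973DegreeBound, doi:10.1007/BF02566968]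
#4 MonotoneLaw (crux) — MONOTONE SYNDROME LAW (replaces card K3(b), found false by the planner: the
syndrome DP is monotone, so nonnegative representatives of per_n mod J_2 have monotone size ≤ 2n³,
not 2^Ω(n)): there is γ > 0 such that for every r ≥ 2 and large n, every Jerrum–Snir monotone
computation (plain fan-in-two circuit over ℝ≥0) of an f ∈ ℝ≥0[X_n] agreeing with per_n at every
non-Bad_r exponent has size ≥ n^(γ·r) — even without cancellations nothing beats syndrome memory;
shape-tight against 2^r·(n+1)^(r+1); the r = ∞ endpoint (garbage = a tripled line) is the
Jerrum–Snir-type support MonotoneEndpoint, 2^Ω(n). [difficulty: L] (why it might fail: Jerrum–Snir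
rectangle counting is void for cosets: one product gate with profiles {(R,R)} may legally cover all
σ with an invariant ⌊n/2⌋-set, a fraction ≍ n^(−0.086) of S_n (Eberhard–Ford–Green), so no known
monotone method gives even ω(n²) at r = 2; an n^o(r) garbage-sharing scheme may exist.)
[JerrumSnir1982, Valiant1980, doi:10.1093/imrn/rnv371, arXiv:2109.06941]
#9 GradedToUniform (support) — (glue) GradedLaw → UniformLaw: given c take r with γ·r ≥ c + 1;
n^(c+1) > n^c + c for n ≥ c + 2 (real-exponent bookkeeping, Real.rpow_natCast). [difficulty:
provable-now] [Burgisser2000]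
#9 MonotoneEndpoint (support) — MONOTONE ENDPOINT (r = ∞ of MonotoneLaw is a Jerrum–Snir theorem;
the crux's content is the interpolation): for n ≥ 3, every monotone computation of a HOMOGENEOUS
degree-n f ∈ ℝ≥0[X_n] agreeing with per_n at every exponent without a tripled line has ≥ C(n, ⌊n/3⌋)
product gates — by the tree's IsMonotoneComputation.exists_decomposition (f = Σ_{t≤J} a_t·b_t, ⌊n/3⌋
< deg a_t ≤ 2⌊n/3⌋, J ≤ prodCount), rook-legal α ∈ supp a_t and β ∈ supp b_t that complete to
permutation monomials must all share ONE profile (R_t, C_t) (a cross product αβ′ has line degrees ≤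
2, lies in supp f, hence is a permutation monomial), so gate t covers ≤ d_t!(n−d_t)! ≤ n!/C(n,⌊n/3⌋)
of the n! permutation monomials. [difficulty: M] [JerrumSnir1982, arXiv:2109.06941, Valiant1980]
#9 OrderedLaw (support) — IMMUNE NISAN FLATTENING (card P2(b), the ordered rung; exponent exactly
r−1): for n = k + l, 1 ≤ r ≤ k + 1 and every P ≡ per_(k+l) mod J_r, the coefficient matrix M_P[a, b]
= coeff_P(rows 0..k−1 ↦ columns a(·), rows k..k+l−1 ↦ columns b(·)) (a : Fin k ↪ Fin n, b : Fin l ↪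
Fin n) has rank ≥ C(l + r − 1, r − 1): on the anticode {k-sets ⊇ F}, |F| = k − r + 1, against
complements, M_P is an identity matrix (diagonal = permutation monomials, coefficient 1;
off-diagonal = 1..r−1 doubled columns, no triple, forced 0). rank M_P bounds below the width of
every row-ordered ABP / nc-ABP computing P, and the syndrome DP is a row-ordered ABP of width ≤
(2n+2)^(r−1). [difficulty: M] [Nisan1991Noncommutative, Delsarte1973, AndrewsForbes2022]
#9 DepthThreeRung (support) — HOMOGENEOUS ΣΠΣ RUNG (card P2(a)): if Σ_{a<s} Π_{i<n} ℓ_{a,i} ≡ per_n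
mod J_r with linear forms ℓ_{a,i} = Σ_v c_{a,i,v} x_v and r ≥ 1, then s ≥ C(n, ⌊(r−1)/2⌋): with j =
⌊(r−1)/2⌋, the order-j partial-derivative coefficient minor (rows: one j-rook placement per
(row-set, column-set) pair; columns: complementary (n−j)-rook placements) is the identity of size
C(n,j)² (off-diagonal monomials have 1..2j ≤ r−1 doubled lines), while ∂^(=j) of a product of n
linear forms spans ≤ C(n,j) dimensions. Against s ≤ (2n+2)^(r−1) (character form of the syndrome
representative): exponent in [(r−1)/2, r−1]. [difficulty: L] [NisanWigderson1996,
GuptaKamathKayalSaptharishi2013, Pratt2019]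
#9 SyndromeRepresentative (support) — SYNDROME LEMMA (the buy-back device; generalises the card's
orthogonal-array Glynn formula, which is its Fourier transform): for an abelian group G and g : [n]
→ G with Σ_A g ≠ Σ_B g whenever A, B ⊆ [n] are disjoint, |A| = |B| ∈ [1, r−1], the 0/1 polynomial
f_g := Σ over maps j : rows → columns with Σ_i g(j(i)) = Σ_c g(c) of Π_i x_{i,j(i)} satisfies f_g ≡
per_n mod J_r (a non-bijective j with q ∈ [1, r−1] doubled and q empty columns shifts the syndrome
by Σ_doubled g − Σ_empty g ≠ 0; q ≥ r doubled or a tripled column is Bad_r; rows never collide).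
[difficulty: M] [Pratt2019, KoutisWilliams2009, doi:10.1016/0196-6774(86)90019-2, Glynn2010]
#9 CounterRepresentative (support) — THE PERMANENT IS A MOD-n COUNTER AWAY FROM A PRODUCT OF LINEAR
FORMS (r = 2, G = ℤ/n, g(j) = j): f := Σ_{j : Σ_i j(i) ≡ Σ_c c (mod n)} Π_i x_{i,j(i)} ≡ per_n mod
J_2 (one doubled column k and one empty column k′ shift the sum by k − k′ ≢ 0). Consequences
recorded, not filed: f = (1/n)·Σ_{ω^n=1} ω^(−s)·Π_i(Σ_j ω^j x_ij), so κ_2(n) ≤ O(n²·log n) with FFT,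
and the counter DP is a MONOTONE circuit with ≤ 2n³ gates. [difficulty: provable-now] [Glynn2010,
Pratt2019]
#9 SyndromeUpperBound (support) — DESIGN/SYNDROME UPPER BOUND: for every r ≥ 1 there is C with
κ_r(n) ≤ C·(n+1)^(r+1) for all n: G = (ℤ/p)^(r−1) with p prime in (n, 2n+2] (Bertrand), g(j) = (j,
j², …, j^(r−1)); for |A| = |B| = q ≤ r−1 < p equal power sums give equal e_1..e_q by Newton's
identities (invertible mod p), hence Π_{a∈A}(x−a) = Π_{b∈B}(x−b) in 𝔽_p[x] and A = B — so
SyndromeRepresentative applies; the character expansion f_g = p^(−(r−1))·Σ_χ χ(−s)·Π_i(Σ_j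
χ(g(j))·x_ij) is a ΣΠΣ FORMULA with p^(r−1) ≤ (2n+2)^(r−1) products of n linear forms, size ≤
2^r·(n+1)^(r+1) by the subadditive API alone (complexity_add_le / mul_le / smul_le, no shared
gates). r = 1: Π_i Σ_j x_ij, size n² − 1. [difficulty: L] [doi:10.1007/BF02566968,
doi:10.1016/0196-6774(86)90019-2, Burgisser2000, Glynn2010]
#9 PurePowerAnchor (support) — ANCHOR (card (i)): (Σ_ij x_ij)^n − n!·per_n ∈ J_1(n) — the
coefficient of a degree-n monomial m in (Σx)^n is n!/Π m(ij)!, and m ∉ Bad_1 forces all row and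
column degrees ≤ 1, i.e. m is a permutation monomial with coefficient n!: the permanent is a pure
n-th power once every collision is forgiven. [difficulty: M] [Glynn2010, RanestadSchreyer2011]
#9 CoeffAgreement (support) — DICTIONARY: P − per_n ∈ J_r(n) iff P and per_n have the same
coefficient at every exponent d that is not Bad_r (Bad_r is an upper set for divisibility, so
Ideal.span of the Bad_r monomials is the set of polynomials supported on Bad_r; Mathlib
MvPolynomial.mem_ideal_span_monomial_image). [difficulty: provable-now] [AndrewsForbes2022,
Burgisser2000]

TWO-LAYER PLAN. Foreseen glued splits (k ≤ 3, depth 1), filed only after a crux moves: GradedLaw ⇐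
CollisionAmplification (card K1: κ_(r+1)(n + b) ≥ n^γ·κ_r(n)/b,
a self-reduction lowering r at polynomial loss) → AmplifyToGraded (induction from κ_1 ≥ (n²−1)/2) →
GradedLaw. FirstRung ⇐ AbpFirstRung (every
algebraic branching program computing a representative of per_n mod J_3 has ≥ n^(2+δ) vertices —
CKSV-type quadratic-plus bounds are the live
technology) → general circuits via a structured depth reduction preserving the coset, if one is
found. MonotoneLaw ⇐ MonotoneSecondCollision
(r = 3: monotone size ≥ n^(2+δ)) → GarbageTolerantParseTrees (a structure theorem for parse trees of
coset computations replacing Jerrum–Snir's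
rectangles: which profile codes a single product gate can serve) → MonotoneLaw.

KILL CRITERIA. ¬UniformLaw (for some c, representatives of size ≤ n^c + c modulo EVERY J_r
infinitely often — equivalently cheap members of per_n + J_∞) closes the
route `refuted:UniformLaw`; there is no repair (the ladder is then bounded) and the witness is a
remarkable algorithmic object to hand to the
algorithms side. ¬GradedLaw alone (κ_r ≤ n^o(r), e.g. n^O(√r)) forces a pivot: serve UniformLaw
directly, drop the amplification child, re-rank
FirstRung to 2. ¬FirstRung (an n^(2+o(1)) representative mod J_3) caps γ ≤ 2/3 and is an alarm, not
a kill: re-file the first rung at the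
smallest r where polynomial room provably remains against the new construction. ¬MonotoneLaw is
informative, not fatal: drop the rung and record
the monotone scheme as a candidate direction for general representatives. MonotoneEndpoint,
OrderedLaw, DepthThreeRung, SyndromeRepresentative, CounterRepresentative,
SyndromeUpperBound, PurePowerAnchor, CoeffAgreement are theorems on paper (checked by the planner;
see Numbers): a refutation there is a
MISSTATEMENT to be repaired by restating, never a reason to close. per ∉ VP_ℂ proved elsewhere moots
the route (UniformLaw stays open as a
stronger statement).

NOT DECOMPOSED YET. The Waring / power-sum rung (card P1: rank of y_1⋯y_n modulo (cubes, ≥ r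
squares) ∈ [C(⌈n/2⌉+r−1, r−1), (2n+2)^(r−1)], the toy model where
Pratt2019 / RanestadSchreyer2011 live) — later, as support. The exact first rungs (κ_1 = n² − Θ(1)?,
κ_2 ∈ [(n²−1)/2, O(n² log n)] — an
FFT-lower-bound-flavoured question) are deliberately not items. CollisionAmplification (card K1) and
depth-4 design extraction (card K3(a):
hom-ΣΠΣΠ representatives of per_n mod J_r need n^Ω(r) — shifted partials made garbage-immune) are
layer-2 children. The single-coset endpoint
X∞ ("per_n + J_∞ has no p-bounded members", J_∞ = a line of degree ≥ 3), implied by UniformLaw and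
still implying VH, is the fallback target.
Sharper constants of SyndromeUpperBound (BCH: (n+1)^(r−1)·n²; FFT: O(r·n^r·log n)), border /
approximative versions, and positive
characteristic (over 𝔽_2 the ladder collapses: per = det, every κ_r p-bounded) are not decomposed.
Definitions collisionIdeal /
collisionComplexity are requested after open; every item is stated inline over existing
declarations.

CHEAPEST FALSIFIER. Run first by the planner, on paper — and it bit: "is there a cheap
CANCELLATION-FREE representative?" Yes: the mod-n counter
Σ_{Σ_i j(i) ≡ Σ c} Π_i x_(i,j(i)) ≡ per_n mod J_2 (monotone, 2n³ gates), in general the syndrome DP;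
this refuted the card's monotone crux
K3(b) and emptied its first rung K2 (at most a log of room left at r = 2) BEFORE filing, and
re-founded the ladder as memory.
For the route as filed the cheapest kills are constructions: (1) kit, n ≤ 7: exact linear algebra
for hom-ΣΠΣ representatives of per_n
mod J_3 with top fan-in < n (DepthThreeRung says none exist — a sanity check of the immunity lemma)
and alternating least squares for general
skeletons of size ≤ 3n² computing a representative mod J_3 (FirstRung predicts failure from n ≈ 6
on); (2) by hand: a representative mod J_3
sharing state across rows and columns with o(n²) memory (planner's attempts — row × column
syndromes, (Σx)^n in ℂ[G_row × G_col] — all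
cost ≥ n⁴); (3) literature: a published limited-independence Koutis–Williams exactness or lower
bound (searched 2026-08-15: none; nearest
arXiv:1807.06194 Thm 53 kills all squares, |G| = 2^n; arXiv:1212.0025 §4 derandomises Glynn only
approximately).

NUMBERS. κ_0 = 0 (J_0 = (1)). κ_1(n) ≤ n² − 1 (Π_i Σ_j x_ij: n(n−1) additions, n−1 products) and ≥
(n²−1)/2 (every x_ij occurs in a coefficient-1
monomial of every representative). κ_2(n) ≤ 2n³ monotone (counter DP: n rows × n residues × n terms)
and O(n² log n) with the length-n DFT per
row (roots of unity are constants of ℂ). κ_r(n) ≤ 2^r·(n+1)^(r+1) (character formula, p ≤ 2n+2;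
filed), ≤ O(r·n^r·log n) with a
Walsh–Hadamard / DFT per row (recorded). Ordered width of the coset ∈ [C(⌈n/2⌉+r−1, r−1),
(2n+2)^(r−1)]: r = 3, n = 20 gives [C(12,2) = 66,
42² = 1764]; hom-ΣΠΣ top fan-in ∈ [C(n,⌊(r−1)/2⌋), (2n+2)^(r−1)]. General circuits: L(per_n) ≤
O(n·2^n) (Ryser/Glynn2010), best lower bound
Ω(n²) (trivial; ChatterjeeKumarSheVolk2022 §1: Baur–Strassen Ω(N log d) needs individual degree d);
hence every ω(n²) bound on any κ_r is
already new for per. Monotone: per_n needs n(2^(n−1)−1) product gates (JerrumSnir1982 §4.3, tree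
JerrumSnir1982_permanent_holds); its coset
mod J_2 has monotone size ≤ 2n³; fraction of σ ∈ S_n with an invariant k-set ≍ k^(−0.086)(log
k)^(−3/2) (doi:10.1093/imrn/rnv371), the
obstruction to rectangle counting. GKKS/Tavenas2015 depth reduction n^O(√n) undercuts n^(γr) only
for r ≳ √n. Monotone endpoint: every nonnegative homogeneous P ≡ per_n mod J_∞
needs ≥ C(n,⌊n/3⌋) product gates (MonotoneEndpoint; C(20,6) = 38760 at n = 20). Items at open: 14 (1
target, 3 cruxes, 9 support, 1 assembly).

DEFINITION REQUESTS. collisionIdeal (r n : ℕ) : Ideal (MvPolynomial (Fin n × Fin n) ℂ) := Ideal.span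
of the monomials d with (∃ i, 3 ≤ rowCount d i) ∨ (∃ j, 3 ≤
colCount d j) ∨ r ≤ #{i | 2 ≤ rowCount d i} + #{j | 2 ≤ colCount d j} (topic
Literature/Computability/AlgebraicComplexity, next to
cosetComplexity; rowCount/colCount exist in PermanentIrreducible.lean), and collisionComplexity r n
:= cosetComplexity (collisionIdeal r n)
(perPoly (Fin n) ℂ); optionally syndromePoly (g : Fin n → G) := Σ_{j : Σ_i g (j i) = Σ_c g c} Π_i X
(i, j i). Filed with `ledger workitem add
--kind definition` after open; no item depends on them (all statements inline), a tenure pass may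
restate over them once landed.

Novelty: Searches (2026-08-15; searchd partly unavailable rc 75, OpenAlex/S2 rate-limited — crossref, arXiv,
local hybrid and galaxy used): `lit search --hybrid
"lower bound permanent arithmetic circuit n^2 log n partial derivatives Baur Strassen"` (12 book
rows, none on point); `lit search --source s2
"superlinear lower bound general arithmetic circuits permanent determinant"` (4:
doi:10.1007/s00037-019-00186-3, arXiv:2109.06941, arXiv:1308.1640);
`--source arxiv "quadratic lower bound algebraic branching programs Chatterjee Kumar She Volk"` →
arXiv:1911.11793, read pp. 3, 5 (state of the art
for general circuits); `--source crossref "Waring rank parameterized exact algorithms"` →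
doi:10.1109/focs.2019.00053 = arXiv:1807.06194, read in full
(Def. 20 support rank, Thm 53 group algebras, §2 Ryser as Waring decomposition); `lit galaxy search
--star all` ×4 ("permanent modulo monomial
ideal", "k-wise independent sample space permanent", "modulo the ideal generated by the squares",
"nonnegative support rank": 0 hits each);
`lit galaxy search --star pdf --mode bm25 "approximating the permanent with limited independence"`
(10: JSV, Dagstuhl/BIRS reports — estimation
only); `--source crossref "permutations fixing a k-set"` → doi:10.1093/imrn/rnv371; `ledger
negatives --problem ValiantsHypothesis` (3, unrelated);
grep of the 56 Theses files of the sub for coset / collision / rook / orthogonal array / Glynn /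
monomial ideal (cosetComplexity only in
HartogsRankTwo); the card's and triage's own  [refs: 10.1007/s00037-019-00186-3, 10.1109/focs.2019.00053, 10.1093/imrn/rnv371, 10.1007/978-3-642-03816-7_8, 10.1016/0196-6774(86, 2109.06941, 1308.1640, 1911.11793, 1807.06194, 1212.0025, doi:10.1007/s00037-019-00186-3, doi:10.1109/focs.2019.00053, doi:10.1093/imrn/rnv371, doi:10.1007/978-3-642-03816-7_8, doi:10.1016/0196-6774, Pratt2019, KoutisWilliams2009, GrochowPitassi2018, AndrewsForbes2022, Nisan]

Barriers (technique_class: coset-avoidance, syndrome-dp, apolarity): - technique_class: coset-avoidance, syndrome-dp, apolarity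
- Literature.Barriers.ValiantsHypothesis.RankMethods: conceded and used where rank methods are
THEOREMS — OrderedLaw and DepthThreeRung are flattening / partial-derivative ranks applied to a
coset on which they are provably tight (exponent r−1 both ways); for general circuits (GradedLaw,
FirstRung) no sub-additive rank measure is proposed — it does not evade the barrier there; the bet
is that fixed-rung, fixed-polynomial coset bounds are a different game from one-shot
super-polynomial ones.
- Literature.Barriers.ValiantsHypothesis.RankLifting: same concession — nothing is lifted from a
restricted-model rank bound to general circuits; the ordered and depth-3 laws are recorded as the
law's shape, not as its engine.
- Literature.Barriers.ValiantsHypothesis.AlgebraicNaturalProofs: the immune-minor bounds are natural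
properties (harmless in restricted models); "every member of per_n + J_r costs n^(γr)" concerns an
affine subspace of coefficient space of codimension #(non-Bad_r exponents), neither large nor
constructive in the FSV/GKSS sense at fixed polynomial size — formally outside the barrier; conceded
for the uniform limit.
- Literature.Barriers.ValiantsHypothesis.PartialDerivativesDetPerm: det and per have equal
derivative-space dimensions, but det ∉ per_n + J_r for all r ≥ 1, n ≥ 2 (det − per = −2Σ_odd x_σ is
rook-legal) and the immune minors read COEFFICIENTS at rook-legal exponents, not dimensions, so the
dimension

History (route lifecycle, newest last):
- 2026-08-15T18:40:43Z · rev 1: restated MonotoneEndpoint (stmt-ValiantsHypothesis-11566) — cone repair 1/3 (route-repair planner): restate support MonotoneEndpoint 1:1 INLINE over ArithCircuit primitives (IsFanInTwo, sum-gate coefficients = 1, Compute (planner-rrepair-ValiantsHypothesis-ForgivenCol-f6a1ebec-0)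
- 2026-08-15T18:44:39Z · rev 2: restated MonotoneLaw (stmt-ValiantsHypothesis-11564) — cone repair 2/3 (route-repair planner): restate crux MonotoneLaw (rank 4) 1:1 INLINE — hypothesis IsMonotoneComputation P f spelled out as P.IsFanInTwo ∧ (every (planner-rrepair-ValiantsHypothesis-ForgivenCol-f6a1ebec-0)
- 2026-08-16T04:20:37Z · AUTO-CRUX (backfill): UniformLaw — hypotheses of the deciding theorem that nothing in the route derives are cruxes (operator:999:1085951)
- 2026-08-23T20:01:48Z · DORMANT — reconciler: no traction for 6.2 d (last activity item-evidence-added at 2026-08-17T14:28:53Z); parked, not closed — `ledger route dormant route-ValiantsHypothes (operator:999:3712509)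

sub-problem: ValiantsHypothesis · status: dormant · opened planner-plancard-ValiantsHypothesis-ValiantsH-8e2d1ffe-0 2026-08-15T18:24:03Z · rev 3 · ledger route-ValiantsHypothesis-ForgivenCollisions
GENERATED by the gate from the ledger (D-0016/17). Provers cite these decls: `theorem foo : Summit.ValiantsHypothesis.ValiantsHypothesis.Theses.ForgivenCollisions.<Decl> := …` in Summits/ValiantsHypothesis/ValiantsHypothesis/Theorems/<Name>.lean.
-/

namespace Summit.ValiantsHypothesis.ValiantsHypothesis.Theses.ForgivenCollisions

open scoped BigOperators Topology Manifold Classical MeasureTheory ProbabilityTheory Matrix InnerProductSpace ComplexConjugate ContinuousMap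
open Filter Set Function TopologicalSpace MeasureTheory

attribute [summit_statement] _root_.ValiantsHypothesis

open Literature.PNP

/-- item stmt-ValiantsHypothesis-11561 · crux (kind.auto-crux: conjecture-grade) · rank 0 · open · by planner
why it might fail: Strictly stronger than per ∉ VP: it already fails if the single coset per_n + J_∞ (garbage = some line of degree ≥ 3) has n^O(1)-size members infinitely often, which VH does not forbid (recovering per_n from such a member costs 3^(2n) interpolation points).
sources: Valiant1979, Burgisser2000, GrochowPitassi2018, AndrewsForbes2022, Glynn2010
[target] UNIFORM COLLISION LAW: for every c there are r, n₀ with κ_r(n) = min{L(P) : P ≡ per_n mod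
J_r(n)} > n^c + c for all n ≥ n₀ (card Assembly-sketch X). -/
@[route_item "route-ValiantsHypothesis-ForgivenCollisions", crux]
def UniformLaw : Prop :=
  ∀ c : ℕ, ∃ r n₀ : ℕ, ∀ n : ℕ, n₀ ≤ n → n ^ c + c < Literature.Computability.AlgebraicComplexity.cosetComplexity (Ideal.span ((fun d : Fin n × Fin n →₀ ℕ => MvPolynomial.monomial d (1 : ℂ)) '' {d | ((∃ i : Fin n, 3 ≤ Literature.Computability.AlgebraicComplexity.rowCount d i) ∨ (∃ j : Fin n, 3 ≤ Literature.Computability.AlgebraicComplexity.colCount d j) ∨ r ≤ (Finset.univ.filter fun i : Fin n => 2 ≤ Literature.Computability.AlgebraicComplexity.rowCount d i).card + (Finset.univ.filter fun j : Fin n => 2 ≤ Literature.Computability.AlgebraicComplexity.colCount d j).card)})) (Literature.Computability.AlgebraicComplexity.perPoly (Fin n) ℂ)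

/-- item stmt-ValiantsHypothesis-11562 · crux · rank 2 · open · by planner
why it might fail: From r > 2/γ on it asserts super-linear (in N = n²) lower bounds for constant-individual-degree cosets; no technique beyond Baur–Strassen Ω(N log d) exists and that needs individual degree d; a representative sharing state across rows AND columns at cost n^o(r) refutes it.
sources: BaurStrassen1983, ChatterjeeKumarSheVolk2022, Nisan1991Noncommutative, Pratt2019, doi:10.1016/0196-6774(86)90019-2, GrochowPitassi2018
[crux] GRADED COLLISION LAW (card THESIS; the engine): there is γ > 0 such that for every r ≥ 1 and
all large n, κ_r(n) ≥ n^(γ·r) — at no fixed rung can general circuits beat syndrome memory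
(n+1)^(r−1) by more than a polynomial in the exponent (γ ≤ 1 is forced by SyndromeUpperBound + FFT,
κ_r ≤ O(r·n^r·log n)). Implies UniformLaw (support GradedToUniform). [difficulty: open-problem] -/
@[route_item "route-ValiantsHypothesis-ForgivenCollisions", crux]
def GradedLaw : Prop :=
  ∃ γ : ℝ, 0 < γ ∧ ∀ r : ℕ, 1 ≤ r → ∃ n₀ : ℕ, ∀ n : ℕ, n₀ ≤ n → (n : ℝ) ^ (γ * r) ≤ ((Literature.Computability.AlgebraicComplexity.cosetComplexity (Ideal.span ((fun d : Fin n × Fin n →₀ ℕ => MvPolynomial.monomial d (1 : ℂ)) '' {d | ((∃ i : Fin n, 3 ≤ Literature.Computability.AlgebraicComplexity.rowCount d i) ∨ (∃ j : Fin n, 3 ≤ Literature.Computability.AlgebraicComplexity.colCount d j) ∨ r ≤ (Finset.univ.filter fun i : Fin n => 2 ≤ Literature.Computability.AlgebraicComplexity.rowCount d i).card + (Finset.univ.filter fun j : Fin n => 2 ≤ Literature.Computability.AlgebraicComplexity.colCount d j).card)})) (Literature.Computability.AlgebraicComplexity.perPoly (Fin n) ℂ) : ℕ) : ℝ)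

/-- item stmt-ValiantsHypothesis-11563 · crux · rank 3 · open · by planner
why it might fail: κ_3 ≤ L(per_n), so this is a super-linear circuit lower bound for the permanent itself, unknown for every constant-individual-degree polynomial (CKSV 2022 §1: only Baur–Strassen/Kalorkoti-type bounds exist); an O(n²·polylog) non-ordered representative mod J_3 beating Sidon memory n²/2 kills it.
sources: BaurStrassen1983, Kalorkoti1985, ChatterjeeKumarSheVolk2022, Strassen1973DegreeBound, doi:10.1007/BF02566968
[crux] FIRST RUNG WITH ROOM: there is δ > 0 with κ_3(n) ≥ n^(2+δ) for all large n — buying back the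
SECOND collision costs a polynomial factor over the input size n² (κ_1 ≤ n² − 1; κ_2 ≤ O(n²·log n)
by the mod-n counter + FFT, so r = 2 has only a log of room and is deliberately not filed; κ_3 ≤
O(n³·log n) by the Sidon syndrome (j, j²) mod p, conjecturally tight). [difficulty: open-problem] -/
@[route_item "route-ValiantsHypothesis-ForgivenCollisions", crux]
def FirstRung : Prop :=
  ∃ δ : ℝ, 0 < δ ∧ ∃ n₀ : ℕ, ∀ n : ℕ, n₀ ≤ n → (n : ℝ) ^ (2 + δ) ≤ ((Literature.Computability.AlgebraicComplexity.cosetComplexity (Ideal.span ((fun d : Fin n × Fin n →₀ ℕ => MvPolynomial.monomial d (1 : ℂ)) '' {d | ((∃ i : Fin n, 3 ≤ Literature.Computability.AlgebraicComplexity.rowCount d i) ∨ (∃ j : Fin n, 3 ≤ Literature.Computability.AlgebraicComplexity.colCount d j) ∨ 3 ≤ (Finset.univ.filter fun i : Fin n => 2 ≤ Literature.Computability.AlgebraicComplexity.rowCount d i).card + (Finset.univ.filter fun j : Fin n => 2 ≤ Literature.Computability.AlgebraicComplexity.colCount d j).card)})) (Literature.Computability.AlgebraicComplexity.perPoly (Fin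 n) ℂ) : ℕ) : ℝ)

-- earlier MonotoneLaw (stmt-ValiantsHypothesis-11564, replaced 2026-08-15T18:44:39Z -> stmt-ValiantsHypothesis-11849): retired by None — ∃ γ : ℝ, 0 < γ ∧ ∀ r : ℕ, 2 ≤ r → ∃ n₀ : ℕ, ∀ n : ℕ, n₀ ≤ n → ∀ (f : MvPolynomial (Fin n × Fin n) NNReal) (P : Literature.Computability.AlgebraicComplexity.ArithCircuit NNReal (Fin n × Fin n)), (∀ d : Fin n × Fin n →₀ ℕ, ¬ ((∃ i : Fin n, 3 ≤ Literature.Computabilit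
/-- item stmt-ValiantsHypothesis-11849 · crux · rank 4 · open · by planner
why it might fail: Jerrum–Snir rectangle counting is void for cosets: one product gate with profiles {(R,R)} may legally cover all σ with an invariant ⌊n/2⌋-set, a fraction ≍ n^(−0.086) of S_n (Eberhard–Ford–Green), so no known monotone method gives even ω(n²) at r = 2; an n^o(r) garbage-sharing scheme may exist.
sources: JerrumSnir1982, Valiant1980, doi:10.1093/imrn/rnv371, arXiv:2109.06941
[crux] MONOTONE SYNDROME LAW (replaces card K3(b), found false by the planner: the syndrome DP is
monotone, so nonnegative representatives of per_n mod J_2 have monotone size ≤ 2n³, not 2^Ω(n)):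
there is γ > 0 such that for every r ≥ 2 and large n, every Jerrum–Snir monotone computation (plain
fan-in-two circuit over ℝ≥0: every sum gate has all coefficients 1, constants enter only as
operands) of an f ∈ ℝ≥0[X_n] agreeing with per_n at every non-Bad_r exponent has size ≥ n^(γ·r) —
even without cancellations nothing beats syndrome memory; shape-tight against 2^r·(n+1)^(r+1); the r
= ∞ endpoint (garbage = a tripled line) is the Jerrum–Snir-type support MonotoneEndpoint, 2^Ω(n).
MODEL STATED INLINE (cone repair 2026-08-15): the hypothesis P.IsFanInTwo ∧ (∀ sum gates, all
coefficients = 1) ∧ P.Computes f is definitionally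
Literature.Barriers.ValiantsHypothesis.IsMonotoneComputation P f (planner's EquivCheck.lean: Old ↔
New, kernel-checked), restated over ArithCircuit primitives so the route file no longer imports the
barrier file MonotoneGap.lean. [difficulty: L] -/
@[route_item "route-ValiantsHypothesis-ForgivenCollisions", crux]
def MonotoneLaw : Prop :=
  ∃ γ : ℝ, 0 < γ ∧ ∀ r : ℕ, 2 ≤ r → ∃ n₀ : ℕ, ∀ n : ℕ, n₀ ≤ n → ∀ (f : MvPolynomial (Fin n × Fin n) NNReal) (P : Literature.Computability.AlgebraicComplexity.ArithCircuit NNReal (Fin n × Fin n)), (∀ d : Fin n × Fin n →₀ ℕ, ¬ ((∃ i : Fin n, 3 ≤ Literature.Computability.AlgebraicComplexity.rowCount d i) ∨ (∃ j : Fin n, 3 ≤ Literature.Computability.AlgebraicComplexity.colCount d j) ∨ r ≤ (Finset.univ.filter fun i : Fin n => 2 ≤ Literature.Computability.AlgebraicComplexity.rowCount d i).card + (Finset.univ.filter fun j : Fin n => 2 ≤ Literature.Computability.AlgebraicComplexity.colCount d j).card) → MvPolynomial.coeff d f = MvPolynomial.coeff d (Literature.Computability.AlgebraicComplexity.perPoly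 (Fin n) NNReal)) → (P.IsFanInTwo ∧ (∀ args : List (NNReal × Literature.Computability.AlgebraicComplexity.ArithCircuit.Operand NNReal (Fin n × Fin n)), Literature.Computability.AlgebraicComplexity.ArithCircuit.Gate.sum args ∈ P.gates → ∀ a ∈ args, a.1 = 1) ∧ P.Computes f) → (n : ℝ) ^ (γ * r) ≤ (P.size : ℝ)

/-- item stmt-ValiantsHypothesis-11565 · support · rank 9 · closed · proved by Summit.ValiantsHypothesis.ValiantsHypothesis.Theorems.gradedToUniform_proof @ f4d157d9ab70 (prover) · by planner
sources: Burgisser2000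
[support] (glue) GradedLaw → UniformLaw: given c take r with γ·r ≥ c + 1; n^(c+1) > n^c + c for n ≥
c + 2 (real-exponent bookkeeping, Real.rpow_natCast). [difficulty: provable-now] -/
@[route_item "route-ValiantsHypothesis-ForgivenCollisions", crux]
def GradedToUniform : Prop :=
  GradedLaw → UniformLaw

/-- item stmt-ValiantsHypothesis-11567 · support · rank 9 · closed · proved by Summit.ValiantsHypothesis.ValiantsHypothesis.Theorems.orderedLaw_proof @ f4d157d9ab70 (prover) · by planner
sources: Nisan1991Noncommutative, Delsarte1973, AndrewsForbes2022
[support] IMMUNE NISAN FLATTENING (card P2(b), the ordered rung; exponent exactly r−1): for n = k +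
l, 1 ≤ r ≤ k + 1 and every P ≡ per_(k+l) mod J_r, the coefficient matrix M_P[a, b] = coeff_P(rows
0..k−1 ↦ columns a(·), rows k..k+l−1 ↦ columns b(·)) (a : Fin k ↪ Fin n, b : Fin l ↪ Fin n) has rank
≥ C(l + r − 1, r − 1): on the anticode {k-sets ⊇ F}, |F| = k − r + 1, against complements, M_P is an
identity matrix (diagonal = permutation monomials, coefficient 1; off-diagonal = 1..r−1 doubled
columns, no triple, forced 0). rank M_P bounds below the width of every row-ordered ABP / nc-ABP
computing P, and the syndrome DP is a row-ordered ABP of width ≤ (2n+2)^(r−1). [difficulty: M] -/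
@[route_item "route-ValiantsHypothesis-ForgivenCollisions", crux]
def OrderedLaw : Prop :=
  ∀ (k l r : ℕ) (P : MvPolynomial (Fin (k + l) × Fin (k + l)) ℂ), 1 ≤ r → r ≤ k + 1 → P - Literature.Computability.AlgebraicComplexity.perPoly (Fin (k + l)) ℂ ∈ Ideal.span ((fun d : Fin (k + l) × Fin (k + l) →₀ ℕ => MvPolynomial.monomial d (1 : ℂ)) '' {d | ((∃ i : Fin (k + l), 3 ≤ Literature.Computability.AlgebraicComplexity.rowCount d i) ∨ (∃ j : Fin (k + l), 3 ≤ Literature.Computability.AlgebraicComplexity.colCount d j) ∨ r ≤ (Finset.univ.filter fun i : Fin (k + l) => 2 ≤ Literature.Computability.AlgebraicComplexity.rowCount d i).card + (Finset.univ.filter fun j : Fin (k + l) => 2 ≤ Literature.Computability.AlgebraicComplexity.colCount d j).card)}) → (l + r - 1).choose (r - 1) ≤ (Matrix.of fun (a : Fin k ↪ Fin (k + l)) (b : Fin l ↪ Fin (k + l)) => MvPolynomial.coeff ((∑ t : Fin k, Finsupp.single (Fin.castAdd l t, a t) 1) + ∑ t : Fin l, Finsupp.single (Fin.natAdd k t,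 b t) 1) P).rank

/-- item stmt-ValiantsHypothesis-11568 · support · rank 9 · closed · proved by Summit.ValiantsHypothesis.ValiantsHypothesis.Theorems.ForgivenCollisionsDepthThreeRung.depthThreeRung_proof (prover) · by planner
sources: NisanWigderson1996, GuptaKamathKayalSaptharishi2013, Pratt2019
[support] HOMOGENEOUS ΣΠΣ RUNG (card P2(a)): if Σ_{a<s} Π_{i<n} ℓ_{a,i} ≡ per_n mod J_r with linear
forms ℓ_{a,i} = Σ_v c_{a,i,v} x_v and r ≥ 1, then s ≥ C(n, ⌊(r−1)/2⌋): with j = ⌊(r−1)/2⌋, the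
order-j partial-derivative coefficient minor (rows: one j-rook placement per (row-set, column-set)
pair; columns: complementary (n−j)-rook placements) is the identity of size C(n,j)² (off-diagonal
monomials have 1..2j ≤ r−1 doubled lines), while ∂^(=j) of a product of n linear forms spans ≤
C(n,j) dimensions. Against s ≤ (2n+2)^(r−1) (character form of the syndrome representative):
exponent in [(r−1)/2, r−1]. [difficulty: L] -/
@[route_item "route-ValiantsHypothesis-ForgivenCollisions", crux]
def DepthThreeRung : Prop :=
  ∀ (n r s : ℕ) (c : Fin s → Fin n → Fin n × Fin n → ℂ), 1 ≤ r → (∑ a : Fin s, ∏ i : Fin n, ∑ v : Fin n × Fin n, c a i v • (MvPolynomial.X v : MvPolynomial (Fin n × Fin n) ℂ)) - Literature.Computability.AlgebraicComplexity.perPoly (Fin n) ℂ ∈ Ideal.span ((fun d : Fin n × Fin n →₀ ℕ => MvPolynomial.monomial d (1 : ℂ)) '' {d | ((∃ i : Fin n, 3 ≤ Literature.Computability.AlgebraicComplexity.rowCount d i) ∨ (∃ j : Fin n, 3 ≤ Literature.Computability.AlgebraicComplexity.colCount d j) ∨ r ≤ (Finset.univ.filter fun i : Fin n => 2 ≤ Literature.Computability.AlgebraicComplexity.rowCount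 d i).card + (Finset.univ.filter fun j : Fin n => 2 ≤ Literature.Computability.AlgebraicComplexity.colCount d j).card)}) → n.choose ((r - 1) / 2) ≤ s

/-- item stmt-ValiantsHypothesis-11569 · support · rank 9 · closed · proved by Summit.ValiantsHypothesis.ValiantsHypothesis.Theorems.syndromeRepresentative_proof @ 8a75990e2b58 (prover) · by planner
sources: Pratt2019, KoutisWilliams2009, doi:10.1016/0196-6774(86)90019-2, Glynn2010
[support] SYNDROME LEMMA (the buy-back device; generalises the card's orthogonal-array Glynn
formula, which is its Fourier transform): for an abelian group G and g : [n] → G with Σ_A g ≠ Σ_B g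
whenever A, B ⊆ [n] are disjoint, |A| = |B| ∈ [1, r−1], the 0/1 polynomial f_g := Σ over maps j :
rows → columns with Σ_i g(j(i)) = Σ_c g(c) of Π_i x_{i,j(i)} satisfies f_g ≡ per_n mod J_r (a
non-bijective j with q ∈ [1, r−1] doubled and q empty columns shifts the syndrome by Σ_doubled g −
Σ_empty g ≠ 0; q ≥ r doubled or a tripled column is Bad_r; rows never collide). [difficulty: M] -/
@[route_item "route-ValiantsHypothesis-ForgivenCollisions", crux]
def SyndromeRepresentative : Prop :=
  ∀ (n r : ℕ) (G : Type) [AddCommGroup G] (g : Fin n → G), (∀ A B : Finset (Fin n), Disjoint A B → A.card = B.card → 1 ≤ A.card → A.card + 1 ≤ r → ∑ t ∈ A, g t ≠ ∑ t ∈ B, g t) → (∑ j ∈ (Finset.univ : Finset (Fin n → Fin n)).filter (fun j => ∑ i, g (j i) = ∑ c, g c), ∏ i : Fin n, (MvPolynomial.X (i, j i) : MvPolynomial (Fin n × Fin n) ℂ)) - Literature.Computability.AlgebraicComplexity.perPoly (Fin n) ℂ ∈ Ideal.span ((fun d : Fin n × Fin n →₀ ℕ => MvPolynomial.monomial d (1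 : ℂ)) '' {d | ((∃ i : Fin n, 3 ≤ Literature.Computability.AlgebraicComplexity.rowCount d i) ∨ (∃ j : Fin n, 3 ≤ Literature.Computability.AlgebraicComplexity.colCount d j) ∨ r ≤ (Finset.univ.filter fun i : Fin n => 2 ≤ Literature.Computability.AlgebraicComplexity.rowCount d i).card + (Finset.univ.filter fun j : Fin n => 2 ≤ Literature.Computability.AlgebraicComplexity.colCount d j).card)})

/-- item stmt-ValiantsHypothesis-11570 · support · rank 9 · closed · proved by Summit.ValiantsHypothesis.ValiantsHypothesis.Theorems.ForgivenCollisionsCounterRepresentative.CounterRepresentative_proof @ d0c8d461ed3e (prover) · by planner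
sources: Glynn2010, Pratt2019
[support] THE PERMANENT IS A MOD-n COUNTER AWAY FROM A PRODUCT OF LINEAR FORMS (r = 2, G = ℤ/n, g(j)
= j): f := Σ_{j : Σ_i j(i) ≡ Σ_c c (mod n)} Π_i x_{i,j(i)} ≡ per_n mod J_2 (one doubled column k and
one empty column k′ shift the sum by k − k′ ≢ 0). Consequences recorded, not filed: f =
(1/n)·Σ_{ω^n=1} ω^(−s)·Π_i(Σ_j ω^j x_ij), so κ_2(n) ≤ O(n²·log n) with FFT, and the counter DP is a
MONOTONE circuit with ≤ 2n³ gates. [difficulty: provable-now] -/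
@[route_item "route-ValiantsHypothesis-ForgivenCollisions", crux]
def CounterRepresentative : Prop :=
  ∀ n : ℕ, (∑ j ∈ (Finset.univ : Finset (Fin n → Fin n)).filter (fun j => (∑ i, (j i : ℕ)) % n = (∑ c : Fin n, (c : ℕ)) % n), ∏ i : Fin n, (MvPolynomial.X (i, j i) : MvPolynomial (Fin n × Fin n) ℂ)) - Literature.Computability.AlgebraicComplexity.perPoly (Fin n) ℂ ∈ Ideal.span ((fun d : Fin n × Fin n →₀ ℕ => MvPolynomial.monomial d (1 : ℂ)) '' {d | ((∃ i : Fin n, 3 ≤ Literature.Computability.AlgebraicComplexity.rowCount d i) ∨ (∃ j : Fin n, 3 ≤ Literature.Computability.AlgebraicComplexity.colCount d j) ∨ 2 ≤ (Finset.univ.filter fun i : Fin n => 2 ≤ Literature.Computability.AlgebraicComplexity.rowCount d i).card + (Finset.univ.filter fun j : Fin n => 2 ≤ Literature.Computability.AlgebraicComplexity.colCount d j).card)})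

/-- item stmt-ValiantsHypothesis-11571 · support · rank 9 · closed · proved by Summit.ValiantsHypothesis.Theorems.syndromeUpperBound_proof @ 80d252d2391b (prover) · by planner
sources: doi:10.1007/BF02566968, doi:10.1016/0196-6774(86)90019-2, Burgisser2000, Glynn2010
[support] DESIGN/SYNDROME UPPER BOUND: for every r ≥ 1 there is C with κ_r(n) ≤ C·(n+1)^(r+1) for
all n: G = (ℤ/p)^(r−1) with p prime in (n, 2n+2] (Bertrand), g(j) = (j, j², …, j^(r−1)); for |A| =
|B| = q ≤ r−1 < p equal power sums give equal e_1..e_q by Newton's identities (invertible mod p),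
hence Π_{a∈A}(x−a) = Π_{b∈B}(x−b) in 𝔽_p[x] and A = B — so SyndromeRepresentative applies; the
character expansion f_g = p^(−(r−1))·Σ_χ χ(−s)·Π_i(Σ_j χ(g(j))·x_ij) is a ΣΠΣ FORMULA with p^(r−1) ≤
(2n+2)^(r−1) products of n linear forms, size ≤ 2^r·(n+1)^(r+1) by the subadditive API alone
(complexity_add_le / mul_le / smul_le, no shared gates). r = 1: Π_i Σ_j x_ij, size n² − 1.
[difficulty: L] -/
@[route_item "route-ValiantsHypothesis-ForgivenCollisions", crux]
def SyndromeUpperBound : Prop :=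
  ∀ r : ℕ, 1 ≤ r → ∃ C : ℕ, ∀ n : ℕ, Literature.Computability.AlgebraicComplexity.cosetComplexity (Ideal.span ((fun d : Fin n × Fin n →₀ ℕ => MvPolynomial.monomial d (1 : ℂ)) '' {d | ((∃ i : Fin n, 3 ≤ Literature.Computability.AlgebraicComplexity.rowCount d i) ∨ (∃ j : Fin n, 3 ≤ Literature.Computability.AlgebraicComplexity.colCount d j) ∨ r ≤ (Finset.univ.filter fun i : Fin n => 2 ≤ Literature.Computability.AlgebraicComplexity.rowCount d i).card + (Finset.univ.filter fun j : Fin n => 2 ≤ Literature.Computability.AlgebraicComplexity.colCount d j).card)})) (Literature.Computability.AlgebraicComplexity.perPoly (Fin n) ℂ) ≤ C * (n + 1) ^ (r + 1)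

/-- item stmt-ValiantsHypothesis-11572 · support · rank 9 · closed · proved by Summit.ValiantsHypothesis.ValiantsHypothesis.Theorems.ForgivenCollisions.purePowerAnchor_proof @ 8a75990e2b58 (prover) · by planner
sources: Glynn2010, RanestadSchreyer2011
[support] ANCHOR (card (i)): (Σ_ij x_ij)^n − n!·per_n ∈ J_1(n) — the coefficient of a degree-n
monomial m in (Σx)^n is n!/Π m(ij)!, and m ∉ Bad_1 forces all row and column degrees ≤ 1, i.e. m is
a permutation monomial with coefficient n!: the permanent is a pure n-th power once every collision
is forgiven. [difficulty: M] -/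
@[route_item "route-ValiantsHypothesis-ForgivenCollisions", crux]
def PurePowerAnchor : Prop :=
  ∀ n : ℕ, (∑ v : Fin n × Fin n, (MvPolynomial.X v : MvPolynomial (Fin n × Fin n) ℂ)) ^ n - (n.factorial : ℂ) • Literature.Computability.AlgebraicComplexity.perPoly (Fin n) ℂ ∈ Ideal.span ((fun d : Fin n × Fin n →₀ ℕ => MvPolynomial.monomial d (1 : ℂ)) '' {d | ((∃ i : Fin n, 3 ≤ Literature.Computability.AlgebraicComplexity.rowCount d i) ∨ (∃ j : Fin n, 3 ≤ Literature.Computability.AlgebraicComplexity.colCount d j) ∨ 1 ≤ (Finset.univ.filter fun i : Fin n => 2 ≤ Literature.Computability.AlgebraicComplexity.rowCount d i).card + (Finset.univ.filter fun j : Fin n => 2 ≤ Literature.Computability.AlgebraicComplexity.colCount d j).card)})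

/-- item stmt-ValiantsHypothesis-11573 · support · rank 9 · closed · proved by Summit.ValiantsHypothesis.ValiantsHypothesis.Theorems.ForgivenCollisions.coeffAgreement_proof @ 436fd698de69 (prover) · by planner
sources: AndrewsForbes2022, Burgisser2000
[support] DICTIONARY: P − per_n ∈ J_r(n) iff P and per_n have the same coefficient at every exponent
d that is not Bad_r (Bad_r is an upper set for divisibility, so Ideal.span of the Bad_r monomials is
the set of polynomials supported on Bad_r; Mathlib MvPolynomial.mem_ideal_span_monomial_image).
[difficulty: provable-now] -/
@[route_item "route-ValiantsHypothesis-ForgivenCollisions", crux]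
def CoeffAgreement : Prop :=
  ∀ (r n : ℕ) (P : MvPolynomial (Fin n × Fin n) ℂ), P - Literature.Computability.AlgebraicComplexity.perPoly (Fin n) ℂ ∈ Ideal.span ((fun d : Fin n × Fin n →₀ ℕ => MvPolynomial.monomial d (1 : ℂ)) '' {d | ((∃ i : Fin n, 3 ≤ Literature.Computability.AlgebraicComplexity.rowCount d i) ∨ (∃ j : Fin n, 3 ≤ Literature.Computability.AlgebraicComplexity.colCount d j) ∨ r ≤ (Finset.univ.filter fun i : Fin n => 2 ≤ Literature.Computability.AlgebraicComplexity.rowCount d i).card + (Finset.univ.filter fun j : Fin n => 2 ≤ Literature.Computability.AlgebraicComplexity.colCount d j).card)}) ↔ ∀ d : Fin n × Fin n →₀ ℕ, ¬ ((∃ i : Fin n, 3 ≤ Literature.Computability.AlgebraicComplexity.rowCount d i) ∨ (∃ j : Fin n, 3 ≤ Literature.Computability.AlgebraicComplexity.colCount d j) ∨ r ≤ (Finset.univ.filter fun i : Fin n => 2 ≤ Literature.Computability.AlgebraicComplexity.rowCount d i).card + (Finset.univ.filter fun j : Fin n => 2 ≤ Literature.Computability.AlgebraicComplexity.colCount d j).card)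 → MvPolynomial.coeff d P = MvPolynomial.coeff d (Literature.Computability.AlgebraicComplexity.perPoly (Fin n) ℂ)

-- earlier MonotoneEndpoint (stmt-ValiantsHypothesis-11566, replaced 2026-08-15T18:40:43Z -> stmt-ValiantsHypothesis-11733): retired by None — ∀ n : ℕ, 3 ≤ n → ∀ (f : MvPolynomial (Fin n × Fin n) NNReal) (P : Literature.Computability.AlgebraicComplexity.ArithCircuit NNReal (Fin n × Fin n)), f.IsHomogeneous n → (∀ d : Fin n × Fin n →₀ ℕ, ¬ ((∃ i : Fin n, 3 ≤ Literature.Computability.AlgebraicComplexit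
/-- item stmt-ValiantsHypothesis-11733 · support · rank 9 · closed · proved by Summit.ValiantsHypothesis.ValiantsHypothesis.Theorems.monotoneEndpoint_proof @ 353ef77a6b7e (prover) · by planner
sources: JerrumSnir1982, arXiv:2109.06941, Valiant1980
[support] MONOTONE ENDPOINT (r = ∞ of MonotoneLaw is a Jerrum–Snir theorem; the crux's content is
the interpolation): for n ≥ 3, every monotone computation of a HOMOGENEOUS degree-n f ∈ ℝ≥0[X_n]
agreeing with per_n at every exponent without a tripled line has ≥ C(n, ⌊n/3⌋) product gates — by
the Jerrum–Snir structure theorem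
(Literature.Barriers.ValiantsHypothesis.IsMonotoneComputation.exists_decomposition in
MonotoneGapDecomposition.lean, which a Theorems file may import freely: f = Σ_{t≤J} a_t·b_t, ⌊n/3⌋ <
deg a_t ≤ 2⌊n/3⌋, J ≤ #product gates), rook-legal α ∈ supp a_t and β ∈ supp b_t that complete to
permutation monomials must all share ONE profile (R_t, C_t) (a cross product αβ′ has line degrees ≤
2, lies in supp f, hence is a permutation monomial), so gate t covers ≤ d_t!(n−d_t)! ≤ n!/C(n,⌊n/3⌋)
of the n! permutation monomials. MODEL STATED INLINE (cone repair 2026-08-15): "monotone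
computation" = P.IsFanInTwo ∧ (every sum gate has all coefficients 1) ∧ P.Computes f and "#product
gates" = P.gates.countP (prod ↦ true, sum ↦ false) — definitionally
Literature.Barriers.ValiantsHypothesis.IsMonotoneComputation / prodCount of MonotoneGap.lean
(planner's EquivCheck.lean: Old ↔ New, -/
@[route_item "route-ValiantsHypothesis-ForgivenCollisions", crux]
def MonotoneEndpoint : Prop :=
  ∀ n : ℕ, 3 ≤ n → ∀ (f : MvPolynomial (Fin n × Fin n) NNReal) (P : Literature.Computability.AlgebraicComplexity.ArithCircuit NNReal (Fin n × Fin n)), f.IsHomogeneous n → (∀ d : Fin n × Fin n →₀ ℕ, ¬ ((∃ i : Fin n, 3 ≤ Literature.Computability.AlgebraicComplexity.rowCount d i) ∨ (∃ j : Fin n, 3 ≤ Literature.Computability.AlgebraicComplexity.colCount d j)) → MvPolynomial.coeff d f = MvPolynomial.coeff d (Literature.Computability.AlgebraicComplexity.perPoly (Fin n) NNReal)) → (P.IsFanInTwo ∧ (∀ args : List (NNReal × Literature.Computability.AlgebraicComplexity.ArithCircuit.Operand NNReal (Fin n × Fin n)), Literature.Computability.AlgebraicComplexity.ArithCircuit.Gate.sum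 args ∈ P.gates → ∀ a ∈ args, a.1 = 1) ∧ P.Computes f) → n.choose (n / 3) ≤ P.gates.countP (fun g => match g with | Literature.Computability.AlgebraicComplexity.ArithCircuit.Gate.prod _ => true | Literature.Computability.AlgebraicComplexity.ArithCircuit.Gate.sum _ => false)

/-- item stmt-ValiantsHypothesis-11574 · assembly · rank 1 · closed · proved by Summit.ValiantsHypothesis.ValiantsHypothesis.Theorems.ForgivenCollisions.assembly_proof @ eda7ceab7090 (prover) · by planner
sources: Valiant1979, Burgisser2000
[assembly] UniformLaw → GradedLaw → FirstRung → MonotoneLaw → GradedToUniform → MonotoneEndpoint →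
OrderedLaw → DepthThreeRung → SyndromeRepresentative → CounterRepresentative → SyndromeUpperBound →
PurePowerAnchor → CoeffAgreement → ValiantsHypothesis (only UniformLaw is load-bearing; hub). -/
@[route_item "route-ValiantsHypothesis-ForgivenCollisions", crux]
def Assembly : Prop :=
  UniformLaw → GradedLaw → FirstRung → MonotoneLaw → GradedToUniform → MonotoneEndpoint → OrderedLaw → DepthThreeRung → SyndromeRepresentative → CounterRepresentative → SyndromeUpperBound → PurePowerAnchor → CoeffAgreement → _root_.ValiantsHypothesis

/-! D-0027 §2.1 — DECIDING THEOREM (planner-authored via `route open/edit --closes-file`; by planner-plancard-ValiantsHypothesis-ValiantsH-8e2d1ffe-0 2026-08-15T18:24:05Z):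
its hypotheses are this route's items and its conclusion the sub-problem Statement (glue_lint), and it elaborates with this file. -/

@[closes "route-ValiantsHypothesis-ForgivenCollisions"] theorem closes : UniformLaw → GradedLaw → FirstRung → MonotoneLaw → GradedToUniform → MonotoneEndpoint → OrderedLaw → DepthThreeRung → SyndromeRepresentative → CounterRepresentative → SyndromeUpperBound → PurePowerAnchor → CoeffAgreement → Assembly → _root_.ValiantsHypothesis := by
  intro hX _ _ _ _ _ _ _ _ _ _ _ _ _
  refine Summit.ValiantsHypothesis.Hub.valiantsHypothesis_of_not_isVPFamily_per ?_
    (Literature.Computability.AlgebraicComplexity.mem_VP_ofFintype_iff_holds _)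
    (Literature.Computability.AlgebraicComplexity.perFamily_mem_VNP_holds ℂ)
  rintro ⟨-, c, hc⟩
  obtain ⟨r, n₀, h⟩ := hX c
  exact absurd (hc n₀) (not_le.2 (lt_of_lt_of_le (h n₀ le_rfl)
    (Literature.Computability.AlgebraicComplexity.cosetComplexity_le_complexity _ _)))

end Summit.ValiantsHypothesis.ValiantsHypothesis.Theses.ForgivenCollisions
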